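import Summits.QuantumFields.YangMills.Theses.BalabanUVNodes
import Summits.QuantumFields.YangMills.Theorems.BalabanUVNodesN19RateEdgeHolderAtSpineReadingOfRecord13CoPH

/-!
# BalabanUVNodes ∕ N19 — THE ROUTE ITEM K3⁷ `SpineGivenEndpointR13SepCoPH` BY NAME AT THE SPINE READING OF RECORD `crOfRecord₁₃At K₀ jcut sh`
# (`N = 2`): N19's binder from the link reading, N27's extraction clause a THEOREM (modulo the displayed live-selector pin laws), N20 ∕ N21 any-witness

Cell `pub-ymgap`, HUMAN RULING D-0062 (Track A) + D-0149 (work-bound push, director-ym №197), R134 ACCELERATION seat `pub-ymgap-dag-n19-d`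
(N19 NE7, strategy s2 = by-name knit at the record), generation g23; bus INTENT-H (2) (pub-ymgap INBOX l.24844; DECL-DELTA: a NEW file instead of a v1.1 append
to `…N19RateEdgeHolderK3R13SepCoPH` — the 400-line cap).  Route `Summits/QuantumFields/YangMills/Theses/BalabanUVNodes.lean` rev 25, cluster item K3⁷
«SpineGivenEndpointR13SepCoPH» (stmt-QuantumFields-20544); filed `--kind proof --supports` that item `--as helper` (it proves no registered stub: it concludes
the item's decl BY NAME from displayed hypotheses, exactly as dag-n27-c's leaves do).  COUNT-NEUTRAL.  THEOREMS ONLY; 0 `def`; 0 `sorry`; `N = 2`.  Imports the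
Theses file (the item BY NAME) and the sibling H `…N19RateEdgeHolderAtSpineReadingOfRecord13CoPH` (§2 `hybridNE7Under_guarded_datumOfRecord₁₃CoPH_crOfRecord₁₃At_…`,
on dag-n20-d's `crOfRecord₁₃At` and dag-n27-c's XXIVc); leaf D is NOT imported (dag-n27-c: leaves are terminal) — its one-line move
`fun F θ hP hG hθ _ _ ↦ … F θ hP.toCore hG hθ` is repeated.  CITED BY NAME, nothing edited.

WHAT THIS FILE PROVES.  ★★ `spineGivenEndpointR13SepCoPH_of_ratesHolder_linkReading_crOfRecord₁₃At`: for any offset `K₀`, persistence policy `jcut`, shell split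
`sh`, rate reading of record `𝔯 : RateReading₁₃CoPH 2`, run-length selector `ks`, live-selector energy letter `E`, any `β ≤ 1` — from
(i) the link reading `hlink` AT THE SPINE READING OF RECORD (the «v9» ∃-clause VERBATIM under `let S := crOfRecord₁₃At K₀ jcut sh F θ hP g₀ os; let R :=
rateCarriersOfRecord₁₃CoPH 𝔯 F θ hP g₀ os k; let D := datumOfRecord₁₃CoPH F 2 θ hP`, at the item's guard `θ.ZhUnity F 2 ∧ θ.SlotsNondegenerate₁₃ F 2`),
(ii) the live-selector pin laws `hsel` ∕ `hζm` ∕ `hζ0` (under which N27's keyed extraction clause AT THE READING is dag-n20-d's THEOREM — `hx` is GONE as a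
hypothesis), (iii) N20's ∕ N21's faces with ANY weight witnesses at the reading's keyed carriers (`∃ W, RelWeightBound 1 (classSet₁₃ θ K₀ g₀) (weightA₁₃ …)
(weightB₁₃ …) (badClass₁₃ … jcut) W`, `∃ Wsh, ShellWeightBound 1 … (sh …).1 (sh …).2 Wsh`), (iv) K4's β-rates `hrates` ⇒ `SpineGivenEndpointR13SepCoPH`.
So at the reading of record, in the plan's R-β currency, N19's displayed residual is EXACTLY `hlink` and N27's is the pin-law triple; N20 ∕ N21 ∕ K4 read
their own statements.  ★ `…_crOfRecord₁₃At_faces` — the same with N20's ∕ N21's faces at the reading's CANONICAL weights (leaf D's `h20` ∕ `h21` binders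
VERBATIM at `cr := crOfRecord₁₃At K₀ jcut sh`; each a witness for the `∃`-form).
LOCATED (this seat, pub-ymgap INBOX l.25098, for dag-n20-d): the reading of record as landed (p587226) pins the volume letter `vol := 1`; N19's link reading
READS `S.vol` as the physical volume (the (ii-m) clause `∀ K, (Fintype.card (Site (Pf K) (Pf K).K) : ℝ) = S.vol`, the ledger size bound, the multiplicities,
(ii-v)'s `gammaVol ≤ S.vol`, (ii-d)'s `Q.card ≤ S.vol`), so AT `vol = 1` the (ii-m) clause asks a one-site top lattice and `hlink` at the reading is NOT
inhabitable by the family's own lattices (`Fintype.card (Site (F.P n) n) = F.side ^ 4`, dag-n19-w3 p586569 §7) — a vacuity located IN THE READING's letter,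
not in N19; the theorems below never read the value of `vol` and re-elaborate unchanged under a re-pin `vol := F.side ^ 4` (asked of dag-n20-d).

HONEST FRAMING.  Count-neutral kernel bookkeeping; `hlink` (NODE O's world, K2⁷; 0 instances in the tree), the pin laws, the N20 ∕ N21 witnesses and `hrates`
are HYPOTHESES (each 0∕1 today at a general guarded tuple); `K₀ jcut sh 𝔯 ks E` PARAMETERS (`sh` NOT inhabited — NODE O ∕ N21).  The conclusion is the Theses
constant ONLY under those hypotheses — a Pi-type, NOT the bare item: NOT a closure (audit `proof.conditional`), filed `--supports`.  NE7 for Bałaban's two runs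
NOT PRINTED, NOT proved; nothing of Bałaban's asserted or instantiated (K0⁷ OPEN); N19 NOT discharged; K3⁷ NOT closed; Track A count unmoved (5∕27 · A 5∕28).
One finite four-torus at fixed ε, rung (B)+1 — NOT infinite volume, NOT OS on ℝ⁴, NOT a mass gap, NOT Clay.  Standard axioms.  Supersedes nothing; edits
nothing.  Shape references: [Balaban1988Convergent] Thm 2 (2.43) p.262, (2.18) p.257 (NAMES of displayed hypotheses only — nothing asserted).
-/

set_option autoImplicit false

noncomputable section

open Finset MeasureTheory
open scoped BigOperators Matrix Matrix.Norms.L2Operator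

namespace Summit.QuantumFields.YangMills.BalabanUVNodes.N19RateEdgeHolderK3R13SepCoPHAtSpineReading

open Literature.MathematicalPhysics.QuantumFieldTheory.Balaban1983to89
open T4OutputRate T4RecentScale T4GoodClassBudget T4CauchySum T4TowerRateComposition T4TowerRateDischarge
open T4EtaRateMin (Readings NE3Shape)
open T4RateLiaison (GaugeDominated)
open T4CouplingMatching (EventualLowerH)
open FlowStep (RGEqH)
open TreeLengthTorus (TFaceConnected torusTreeLen)
open B12TreeDecay (kappa₀)
open Summit.QuantumFields.BalabanUV.T4Continuum
open AveragingDeficitDualResidual (dualC1 dualC2)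
open AveragingDeficitDerivWallProof (wallConst)
open AveragingDeficitPeriodicCounting (IsPeriodicDir)
open MinimalActionSandwich (IsMinimiser minAct)
open MinimalActionRate (sfClass)
open MinimalActionRefine (RegularSup gradConst)
open NE3EnergyShapes (IsUnitarySite IsPeriodicSite)
open NE3.LeafIndexSockets (LeafH3sup)
open Summit.QuantumFields.BalabanUV.T4Continuum.Spine
open Summit.QuantumFields.BalabanUV.T4Continuum.NE1p.DressedRoot (DressedTower DressedStabilityStrict)
open Summit.QuantumFields.YangMills.BalabanUVNodes.N19LedgerLinkSync (LedgerDataSync LedgerAtSync)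
open YMDAG.UVSplit (SpineCarriers SpineRecordPred InputsPred U3Carriers RateCarriers RateRecordPred N14At N18At N22At ReadOutAt)
open Summit.QuantumFields.YangMills.BalabanUVNodes.N16HolderDefs (CovRootHolder N16HolderAt)
open Summit.QuantumFields.YangMills.BalabanUVNodes.SpineRatesHolder (RatesHolderAt)
open Literature.MathematicalPhysics.QuantumFieldTheory.Balaban1983to89.T4Continuum (T4Family ULoop)
open T4WeightBudget (RelWeightBound)
open T4IndicatorShell (ShellWeightBound)
open T4ContinuumYM4Torus (ForSmallCouplings)
open T4ApexHybrid (HybridNE7Under)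
open YMDAG.UVSplit (Datum RateReading₁₃CoPH rateCarriersOfRecord₁₃CoPH)
open YMDAG.UVSplit (SpineReading₁₃CoPH ShellSplit₁₃CoPH crOfRecord₁₃At crOfRecord₁₃ classSet₁₃ weightA₁₃ weightB₁₃ badClass₁₃)
open Node00 (Stage13HParams datumOfRecord₁₃CoPH SiteSeqKey ppSelLiveOfRecord wOfRecord₉ ZetaMeasurable)
open Summit.QuantumFields.YangMills.Theses.BalabanUVNodes (SpineGivenEndpointR13SepCoPH)
open Summit.QuantumFields.YangMills.BalabanUVNodes.N19RateEdgeHolderAtSpineReadingOfRecord13CoPH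
  (hybridNE7Under_guarded_datumOfRecord₁₃CoPH_crOfRecord₁₃At_of_ratesHolder_linkReading)

/-! ## §1 The route item K3⁷ BY NAME (`N = 2`) AT THE SPINE READING OF RECORD -/

section Item

variable (K₀ : ℕ) (jcut : ℕ → ℕ) (sh : ShellSplit₁₃CoPH 2 K₀)
  (𝔯 : RateReading₁₃CoPH 2) {β : ℝ} (hβ1 : β ≤ 1)
  (hlink : ∀ (F : T4Family) (θ : Stage13HParams F 2) (hP : θ.Provisos₁₃CoPH F 2), (θ.ZhUnity F 2 ∧ θ.SlotsNondegenerate₁₃ F 2) → θ.Admissible F 2 →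
    ∀ (g₀ : ℕ → ℝ) (os : List (ULoop F)) (k : ℕ),
      let S : SpineCarriers := crOfRecord₁₃At K₀ jcut sh F θ hP g₀ os
      let R : RateCarriers 2 := rateCarriersOfRecord₁₃CoPH 𝔯 F θ hP g₀ os k
      let D : Datum F 2 := datumOfRecord₁₃CoPH F 2 θ hP
      letI := S.dec
      ∃ (_ : DecidableEq R.u3.C.Dom) (F' : Type) (ι' X' : Type) (_ : MeasurableSpace ι')
        (L : LedgerDataSync R.u3.C F' ι' S.ι) (Rd : Readings ι' X') (bsel : (ℕ → ℝ) → ℝ) (EB : Functional R.u3.C R.u3.C.BgB)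
        (θc θ₃ : ℝ) (g : ℕ → ℕ → ℝ)
        (uA : ℕ → ι' → R.u3.C.BgA) (uB : ℕ → ι' → R.u3.C.BgB)
        (Pf : ℕ → Params) (d₀ L₀ Koff : ℕ) (cells : (K j : ℕ) → R.u3.C.Dom → Finset (Site (Pf K) j))
        (H033 : Flow → ℕ → Prop) (I : Type) (fam : I → B14.Sect2Data) (Lb βw : ℝ) (κ₁ : ℕ) (Gv Cl : ℝ) (K₁ : ℕ)
        (Λ₀ N₀ : ℝ) (dressed : R.u3.C.Dom → Prop) (_ : DecidablePred dressed)
        -- N16-side letters: regime, selection, reading map, NE7 route-#1 side letters, offset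
        (c' t ε₁ θ γ₃ l₁ : ℝ)
        (sel : ℕ → (B7Prop1Explicit.Site 4 → Fin 4 → (Matrix (Fin 2) (Fin 2) ℂ)ˣ) → (B7Prop1Explicit.Site 4 → Fin 4 → (Matrix (Fin 2) (Fin 2) ℂ)ˣ))
        (rd : ι' → (B7Prop1Explicit.Site 4 → Fin 4 → (Matrix (Fin 2) (Fin 2) ℂ)ˣ)) (k₀ : ℕ)
        -- N17-side letters: infrared pin, β-window
        (gIR bβ : ℝ) (k₀β : ℕ)
        -- TUBE letters of the bracket (T): the (1.18) constant, the layer factor and (2.28)'s `C₁, q₁`, the flow's `β′`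
        (E₀T κ₁T C₁T β'T : ℝ) (q₁ : ℕ),
        -- the run-B functional is the first-coupling family read through the selector
        EB = (fun s => R.u3.EB (bsel s) s) ∧
        -- (i) the ledger predicate for whatever size data and census constants meet their clauses
        (∀ (Sz : ℕ → ℝ → S.ι → ℕ → ℝ) (E₀ : ℝ) (m : ℕ) (a : ℝ) (Cw Λg : ℝ),
          (∀ K t, |t| ≤ S.l₀ → ∀ τ ∈ S.T K \ S.Bad K t, ∀ v ∈ Rd.dom, ∀ j ≤ K,
            |∑ X ∈ L.fac K t τ with R.u3.C.scale X = j,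
                (Real.log (Real.exp (EB (fun i => g (K + 1) (i + 1)) (uB K v) X
                    - EB (fun i => g (K + 1) (i + 1)) L.oneB X))
                  - Real.log (Real.exp (R.u3.EA (g K) (uA K v) X - R.u3.EA (g K) L.oneA X)))| ≤ Sz K t τ j) →
          0 ≤ E₀ → 0 < a → a < 1 →
          (∀ K t, |t| ≤ S.l₀ → ∀ τ ∈ S.T K \ S.Bad K t, ∀ j ≤ K,
            Sz K t τ j ≤ S.vol * (E₀ * ((K : ℝ) + 1) ^ m * a ^ (K - j))) →
          (∀ K, Multiplicity (L.All K) R.u3.C.scale (fun X => Real.exp (-(R.u3.κ * R.u3.C.d X))) Cw S.vol Λg K) →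
          (∀ K t, |t| ≤ S.l₀ → ∀ τ ∈ S.T K \ S.Bad K t,
            WindowMultiplicity (L.facO K t τ) L.scO L.wO Cw S.vol Λg (jlogOf L.Cl K) K) →
          1 ≤ Λg → L.θ' ≤ Λg →
          LedgerAtSync { L with S := Sz, E₀ := E₀, m := m, a := a, Cw := Cw, Λg := Λg } S.l₀ S.vol S.T S.Bad
            (fun K t τ => S.A K t τ - S.shA K t τ) (fun K t τ => S.B K t τ - S.shB K t τ) Rd R.u3.EA EB R.u3.κ g uA uB
            R.u3.ω θc R.u3.θ θ₃) ∧
        0 ≤ S.vol ∧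
        (∀ K t, |t| ≤ S.l₀ → ∀ τ ∈ S.T K \ S.Bad K t,
          WindowMultiplicity (L.facO K t τ) L.scO L.wO L.Cw S.vol L.Λg (jlogOf L.Cl K) K) ∧
        0 ≤ L.Cw ∧ 1 ≤ L.Λg ∧ L.θ' ≤ L.Λg ∧
        -- (ii-m) the reference ledger's lattice identification
        (∀ K, (Pf K).d = d₀) ∧ (∀ K, (Pf K).L = L₀) ∧ (∀ K, (Pf K).K = Koff + K) ∧
        (∀ K, (Fintype.card (Site (Pf K) (Pf K).K) : ℝ) = S.vol) ∧
        kappa₀ (4 * 2 ^ d₀) (2 * d₀) ≤ R.u3.κ ∧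
        (∀ K, ∀ X ∈ L.All K,
          (cells K (R.u3.C.scale X + Koff) X).Nonempty ∧ TFaceConnected (cells K (R.u3.C.scale X + Koff) X)) ∧
        (∀ K j, Set.InjOn (cells K j) ↑((L.All K).filter fun X => R.u3.C.scale X + Koff = j)) ∧
        (∀ K, ∀ X ∈ L.All K, torusTreeLen (cells K (R.u3.C.scale X + Koff) X) ≤ R.u3.C.d X) ∧
        -- (iii) [III] Theorem 2 (2.43) AS PRINTED with window letters
        B14.Thm2Printed H033 fam Lb βw κ₁ ∧ βw < 1 ∧ 0 < βw ∧ 1 < Lb ∧ 1 ≤ Gv ∧ 0 ≤ Cl ∧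
        -- (iv) the positional-count half of N14's pinned pair at a rate `≤ R.ne1.Λ`
        (∀ p K, (R.ne1.𝒯.B p K).PositionalCount fun j k => N₀ * Λ₀ ^ (k - j)) ∧ 0 ≤ N₀ ∧ 0 ≤ Λ₀ ∧ Λ₀ ≤ R.ne1.Λ ∧
        -- (ii-v-A) run A's vacuum slices ↔ printed E-terms
        (∀ K t, |t| ≤ S.l₀ → ∀ τ ∈ S.T K \ S.Bad K t, ∀ v ∈ Rd.dom, ∀ j ≤ K, ∃ (i : I) (w : (fam i).Ω) (j' : ℕ),
          (fam i).flow.SatisfiesRG (fam i).K ∧ H033 (fam i).flow (fam i).K ∧ 1 ≤ j' ∧ j' ≤ (fam i).K ∧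
          (fam i).K - j' = K - j ∧ (fam i).K ≤ K + K₁ ∧
          (∀ n, 0 ≤ (fam i).gammaVol n w) ∧ (fam i).gammaVol (fam i).K w ≤ S.vol ∧
          (∀ n, n < (fam i).K → n < jlogOf Cl (fam i).K → (fam i).gammaVol n w = 0) ∧
          (∀ n, n < (fam i).K → jlogOf Cl (fam i).K ≤ n → (fam i).gammaVol n w ≤ S.vol * Gv ^ ((fam i).K - n)) ∧
          |∑ X ∈ (L.fac K t τ).filter (fun X => ¬ dressed X) with R.u3.C.scale X = j,
              (R.u3.EA (g K) (uA K v) X - R.u3.EA (g K) L.oneA X)| ≤ |(fam i).eTerm j' (fam i).K w|) ∧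
        -- (ii-v-B) run B's vacuum slices ↔ printed E-terms
        (∀ K t, |t| ≤ S.l₀ → ∀ τ ∈ S.T K \ S.Bad K t, ∀ v ∈ Rd.dom, ∀ j ≤ K, ∃ (i : I) (w : (fam i).Ω) (j' : ℕ),
          (fam i).flow.SatisfiesRG (fam i).K ∧ H033 (fam i).flow (fam i).K ∧ 1 ≤ j' ∧ j' ≤ (fam i).K ∧
          (fam i).K - j' = K - j ∧ (fam i).K ≤ K + K₁ ∧
          (∀ n, 0 ≤ (fam i).gammaVol n w) ∧ (fam i).gammaVol (fam i).K w ≤ S.vol ∧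
          (∀ n, n < (fam i).K → n < jlogOf Cl (fam i).K → (fam i).gammaVol n w = 0) ∧
          (∀ n, n < (fam i).K → jlogOf Cl (fam i).K ≤ n → (fam i).gammaVol n w ≤ S.vol * Gv ^ ((fam i).K - n)) ∧
          |∑ X ∈ (L.fac K t τ).filter (fun X => ¬ dressed X) with R.u3.C.scale X = j,
              (EB (fun i => g (K + 1) (i + 1)) (uB K v) X - EB (fun i => g (K + 1) (i + 1)) L.oneB X)|
            ≤ |(fam i).eTerm j' (fam i).K w|) ∧
        -- (ii-d) the dressed sub-ledger ↔ N14's bookings on `R.ne1.𝒯`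
        (∀ K t, |t| ≤ S.l₀ → ∀ τ ∈ S.T K \ S.Bad K t, ∀ v ∈ Rd.dom,
          ∃ (pA : R.ne1.P) (βA : R.u3.C.Dom → (R.ne1.𝒯.B pA K).Birth) (Q : Finset (R.ne1.𝒯.B pA K).Cube) (pB : R.ne1.P)
            (KB : ℕ) (βB : R.u3.C.Dom → (R.ne1.𝒯.B pB KB).Birth),
          (∀ X ∈ (L.fac K t τ).filter (fun X => dressed X), (R.ne1.𝒯.B pA K).birthScale (βA X) = R.u3.C.scale X) ∧
          (∀ j, Set.InjOn βA ↑(((L.fac K t τ).filter (fun X => dressed X)).filter fun X => R.u3.C.scale X = j)) ∧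
          (∀ c ∈ Q, (R.ne1.𝒯.B pA K).cubeScale c = K) ∧ ((Q.card : ℝ) ≤ S.vol) ∧
          (∀ X ∈ (L.fac K t τ).filter (fun X => dressed X), ∃ c ∈ Q, βA X ∈ (R.ne1.𝒯.B pA K).feltAt c) ∧
          (∀ X ∈ (L.fac K t τ).filter (fun X => dressed X), KB - (R.ne1.𝒯.B pB KB).birthScale (βB X) = K - R.u3.C.scale X) ∧
          (∀ X ∈ (L.fac K t τ).filter (fun X => dressed X),
            |R.u3.EA (g K) (uA K v) X - R.u3.EA (g K) L.oneA X| ≤ (R.ne1.𝒯.B pA K).size (βA X) K) ∧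
          (∀ X ∈ (L.fac K t τ).filter (fun X => dressed X),
            |EB (fun i => g (K + 1) (i + 1)) (uB K v) X - EB (fun i => g (K + 1) (i + 1)) L.oneB X|
              ≤ (R.ne1.𝒯.B pB KB).size (βB X) KB)) ∧
        -- (v′-16) N16 BY NAME: THE END's regime letters of `R.ne3`, N07's interface, the selection, NE7 route-#1's side letters, the
        -- reading map, the action-reading identification, the offset, the gauge-domination convention
        R.ne3.g = gradConst 4 c' ∧ 2 ≤ R.ne3.L ∧ 1 ≤ R.ne3.Nper ∧ 0 ≤ R.ne3.b ∧ 0 ≤ c' ∧ R.ne3.b ≤ t ∧ c' ≤ t ∧ 0 ≤ R.ne3.C ∧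
        (2 : ℝ) ^ 91 * (R.ne3.L : ℝ) ^ 17 * t ≤ 1 ∧ (2 : ℝ) ^ 76 * (R.ne3.L : ℝ) ^ 12 * t ≤ R.ne3.ε ∧
        16 * B7Prop2Explicit.C0 4 * R.ne3.ε ≤ 3 ∧ 1024 * (4 + 1) * (4 + 4) * (R.ne3.L : ℝ) ^ 2 * R.ne3.ε ≤ 1 ∧
        ε₁ ≤ 1 / 4 ∧ ε₁ ≤ R.ne3.b ∧ 4 * ε₁ ≤ c' ∧ R.ne3.dom ⊆ sfClass 4 R.ne3.L R.ne3.Nper ε₁ 0 ∧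
        LeafH3sup 4 R.ne3.L R.ne3.Nper R.ne3.ε R.ne3.b c' R.ne3.dom ∧
        (∀ V ∈ R.ne3.dom, ∀ k : ℕ, IsMinimiser 4 (sfClass 4 R.ne3.L R.ne3.Nper R.ne3.ε) R.ne3.L R.ne3.Nper k V (sel k V)) ∧
        (∀ V ∈ R.ne3.dom, ∀ k : ℕ, RegularSup 4 R.ne3.L R.ne3.Nper R.ne3.b c' k (sel k V)) ∧
        0 < θ ∧ θ ^ 6 = ((R.ne3.L : ℝ))⁻¹ ∧ 0 < R.ne3.Λ₂' ∧ 0 < γ₃ ∧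
        R.ne3.C * (wallConst 4 R.ne3.L * (R.ne3.Nper : ℝ) ^ 2 *
          (Real.sqrt (gradConst 4 c') * dualC2 4 R.ne3.L + 2 * R.ne3.b ^ 2 * dualC1 4 R.ne3.L)) ≤ γ₃ ^ 3 ∧
        0 < l₁ ∧ R.ne3.Λ₁ ≤ l₁ ^ 3 ∧ γ₃ * θ ^ 2 ≤ l₁ * R.ne3.Nper ∧ θ ^ ((3 : ℝ) * β - 2) ≤ θ₃ ∧ θ₃ < 1 ∧
        (∀ v ∈ Rd.dom, rd v ∈ R.ne3.dom) ∧
        (∀ k, ∀ v ∈ Rd.dom, Rd.act k v = minAct 4 (sfClass 4 R.ne3.L R.ne3.Nper R.ne3.ε) R.ne3.L R.ne3.Nper k (rd v)) ∧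
        (R.ne3.Nper : ℝ) ^ 4 ≤ Rd.vol ∧ 1 ≤ k₀ ∧
        (∀ K : ℕ, ∀ v ∈ Rd.dom, ∀ (u : B7Prop1Explicit.Site 4 → (Matrix (Fin 2) (Fin 2) ℂ)ˣ)
          (Z : B7Prop1Explicit.Site 4 → Fin 4 → Matrix (Fin 2) (Fin 2) ℂ) (M : ℝ),
          IsUnitarySite u → IsPeriodicSite u ((R.ne3.Nper * R.ne3.L ^ (k₀ + K) : ℕ) : ℤ) → T4AveragingDeficitWall.IsSkewDir Z →
          IsPeriodicDir Z ((R.ne3.Nper * R.ne3.L ^ (k₀ + K) : ℕ) : ℤ) →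
          B7Prop1Explicit.gaugeAct u (sel (k₀ + K) (rd v)) =
            T4AveragingDeficitWall.vary (B7Prop2Explicit.rescale R.ne3.L (B7Prop1Explicit.bavg R.ne3.L (sel (k₀ + K + 1) (rd v)))) Z 1 →
          (∀ (x : B7Prop1Explicit.Site 4) (κ : Fin 4), (R.ne3.L : ℝ) ^ (k₀ + K) * ‖Z x κ‖ ≤ M) →
          (∀ (x : B7Prop1Explicit.Site 4) (μ κ : Fin 4), ((R.ne3.L : ℝ) ^ (k₀ + K)) ^ 2 *
              ‖T4AveragingDeficitWall.Ad (B7Prop2Explicit.rescale R.ne3.L (B7Prop1Explicit.bavg R.ne3.L (sel (k₀ + K + 1) (rd v)))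
                  (x + B7Prop1Explicit.e κ) μ) (Z (x + B7Prop1Explicit.e μ) κ) - Z x κ‖ ≤ M) →
          R.u3.C.gauge (uA K v) (R.u3.C.transport (uB K v)) ≤ M) ∧
        -- letter signs
        0 ≤ R.u3.θ ∧ 0 ≤ R.u3.C₅ ∧ 0 ≤ R.u3.ω ∧
        -- (v′-17) N17 BY NAME: the (0.20)-run identification, the infrared pin, (D4), the β-window, the smallness window, rates
        (∀ K, RGEqH K D.βfun (g K)) ∧ (∀ K, g K K = gIR) ∧ ReadOutAt D R.u3 ∧ 0 < bβ ∧
        EventualLowerH bβ R.u3.γ k₀β D.βfun ∧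
        R.u3.cr * R.u3.C₉ * R.u3.ω * (((k₀β : ℝ) + 1) * R.u3.γ ^ 3 + 2 * R.u3.γ / bβ) ≤ (1 - R.u3.ρ) / 2 ∧
        0 < R.u3.ρ ∧ R.u3.ρ < 1 ∧ 0 < R.u3.γ ∧ R.u3.ρ ≤ θc ∧
        -- the box
        (∀ K i, i ≤ K → 0 < g K i ∧ g K i ≤ R.u3.γ) ∧
        -- the bracket (T) IN THE TUBE CURRENCY (`N19LipBracketTube.lipBracket_at_rateCarriers_of_pairDisc`'s inputs): the (1.18) real
        -- bound; the pair-disc shape at the printed tube radius κ₁·α(C₁, q₁, s_j) ((2.27)(ii)(iv) through the (1.13)∕(2.39) tube — SHAPE,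
        -- NODE O); signs; the window's smallness; the UPPER running of the tables ((2.6) ∕ (0.31) upper half, β-side conditional, DISPLAYED)
        DecayBound R.u3.EA R.u3.W E₀T R.u3.κ ∧
        (∀ s ∈ R.u3.W, ∀ (X : R.u3.C.Dom) (U U' : R.u3.C.BgA),
          R.u3.C.gauge U U' < κ₁T * B14.alphaJ C₁T q₁ (s (R.u3.C.scale X)) →
          ∃ f : ℂ → ℂ, DifferentiableOn ℂ f (Metric.ball (0 : ℂ) (κ₁T * B14.alphaJ C₁T q₁ (s (R.u3.C.scale X)))) ∧
            f 0 = (R.u3.EA s U X : ℂ) ∧ f (R.u3.C.gauge U U' : ℂ) = (R.u3.EA s U' X : ℂ) ∧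
            ∀ z ∈ Metric.ball (0 : ℂ) (κ₁T * B14.alphaJ C₁T q₁ (s (R.u3.C.scale X))),
              ‖f z‖ ≤ E₀T * Real.exp (-(R.u3.κ * R.u3.C.d X))) ∧
        0 ≤ E₀T ∧ 0 < κ₁T ∧ 0 < C₁T ∧ (∀ s ∈ R.u3.W, ∀ j, 0 < s j ∧ s j ^ 2 ≤ Real.exp (-1)) ∧
        (∀ K j, j ≤ K → 1 / g K j ^ 2 ≤ 1 / gIR ^ 2 + β'T * ((K : ℝ) - j)) ∧ 0 ≤ β'T ∧
        -- window memberships, selector compatibility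
        (∀ K, g K ∈ R.u3.W) ∧ (∀ K, (fun i => g (K + 1) (i + 1)) ∈ R.u3.W) ∧
        (∀ s ∈ R.u3.W, 0 < bsel s ∧ bsel s ≤ R.u3.γ))

include hβ1 hlink

/-- ★★ **K3⁷ `SpineGivenEndpointR13SepCoPH` BY NAME AT THE SPINE READING OF RECORD** [bookkeeping]: the sibling H's §2
`hybridNE7Under_guarded_datumOfRecord₁₃CoPH_crOfRecord₁₃At_of_ratesHolder_linkReading` (= dag-n27-c XXIVc `keyedGuarded₁₃CoPH_of_keyedFacesRatesHolder` at
`cr := crOfRecord₁₃At K₀ jcut sh`) at the item's guard `θ.ZhUnity F 2 ∧ θ.SlotsNondegenerate₁₃ F 2`, read at `hP.toCore` exactly as leaf D reads the item.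
DISPLAYED: `hβ1`, `hlink` (NODE O's world, at the reading of record), the run-length selector `ks`, the live-selector energy letter `E` and pin laws `hsel` ∕ `hζm` ∕
`hζ0` (under which N27's keyed extraction clause at the reading is dag-n20-d's THEOREM `keyedExtraction_crOfRecord₁₃At`), N20's ∕ N21's faces with ANY weight
witnesses at the reading's keyed carriers, K4's β-rates `hrates`.  The conclusion is the Theses constant itself, ONLY under those hypotheses (each 0∕1 today) —
NOT a closure of K3⁷; NOT NE7; N19 NOT discharged. [folklore] -/
theorem spineGivenEndpointR13SepCoPH_of_ratesHolder_linkReading_crOfRecord₁₃At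
    (ks : (F : T4Family) → (θ : Stage13HParams F 2) → θ.Provisos₁₃CoPH F 2 → (ℕ → ℝ) → List (ULoop F) → ℕ)
    (E : (F : T4Family) → (θ : Stage13HParams F 2) → θ.Provisos₁₃CoPH F 2 → B12.RunParams → ℝ)
    (hsel : ∀ (F : T4Family) (θ : Stage13HParams F 2) (hP : θ.Provisos₁₃CoPH F 2), (θ.ZhUnity F 2 ∧ θ.SlotsNondegenerate₁₃ F 2) → θ.Admissible F 2 →
      θ.ppSel = ppSelLiveOfRecord F 2 θ.ν θ.τ9 (E F θ hP) (wOfRecord₉ F 2 θ.toStage9Params))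
    (hζm : ∀ (F : T4Family) (θ : Stage13HParams F 2) (hP : θ.Provisos₁₃CoPH F 2), (θ.ZhUnity F 2 ∧ θ.SlotsNondegenerate₁₃ F 2) → θ.Admissible F 2 →
      ZetaMeasurable F 2 θ.ζ)
    (hζ0 : ∀ (F : T4Family) (θ : Stage13HParams F 2) (hP : θ.Provisos₁₃CoPH F 2), (θ.ZhUnity F 2 ∧ θ.SlotsNondegenerate₁₃ F 2) → θ.Admissible F 2 →
      ∀ p g k s Pl Ql RS U V', 0 ≤ θ.ζ p g k s Pl Ql RS U V')
    (h20 : ∀ (F : T4Family) (θ : Stage13HParams F 2) (hP : θ.Provisos₁₃CoPH F 2), (θ.ZhUnity F 2 ∧ θ.SlotsNondegenerate₁₃ F 2) → θ.Admissible F 2 →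
      ∀ (g₀ : ℕ → ℝ) (os : List (ULoop F)),
      ∃ W : ℕ → ℝ, RelWeightBound 1 (classSet₁₃ θ K₀ g₀) (weightA₁₃ θ hP K₀ g₀ os) (weightB₁₃ θ hP K₀ g₀ os) (badClass₁₃ θ K₀ g₀ jcut) W)
    (h21 : ∀ (F : T4Family) (θ : Stage13HParams F 2) (hP : θ.Provisos₁₃CoPH F 2), (θ.ZhUnity F 2 ∧ θ.SlotsNondegenerate₁₃ F 2) → θ.Admissible F 2 →
      ∀ (g₀ : ℕ → ℝ) (os : List (ULoop F)),
      ∃ Wsh : ℕ → ℝ, ShellWeightBound 1 (classSet₁₃ θ K₀ g₀) (weightA₁₃ θ hP K₀ g₀ os) (weightB₁₃ θ hP K₀ g₀ os) (sh F θ hP g₀ os).1 (sh F θ hP g₀ os).2 Wsh)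
    (hrates : ∀ (F : T4Family) (θ : Stage13HParams F 2) (hP : θ.Provisos₁₃CoPH F 2), (θ.ZhUnity F 2 ∧ θ.SlotsNondegenerate₁₃ F 2) → θ.Admissible F 2 →
      ∀ (g₀ : ℕ → ℝ) (os : List (ULoop F)),
      RatesHolderAt (datumOfRecord₁₃CoPH F 2 θ hP) (rateCarriersOfRecord₁₃CoPH 𝔯 F θ hP g₀ os (ks F θ hP g₀ os)) β) :
    SpineGivenEndpointR13SepCoPH :=
  fun F θ hP hG hθ _ _ =>
    hybridNE7Under_guarded_datumOfRecord₁₃CoPH_crOfRecord₁₃At_of_ratesHolder_linkReading K₀ jcut sh 𝔯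
      (fun θ => θ.ZhUnity _ 2 ∧ θ.SlotsNondegenerate₁₃ _ 2) hβ1 hlink ks E hsel hζm hζ0 h20 h21 hrates F θ hP.toCore hG hθ

/-- ★ **THE SAME WITH N20's ∕ N21's FACES AS LEAF D DISPLAYS THEM AT THE READING** (`RelWeightBound S.l₀ S.T S.A S.B S.Bad S.W` ∕ `ShellWeightBound S.l₀ S.T S.A
S.B S.shA S.shB S.Wsh` for `S := crOfRecord₁₃At K₀ jcut sh F θ hP g₀ os` — the reading's CANONICAL weights; dag-n27-c leaf D's `h20` ∕ `h21` binders VERBATIM at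
`cr := crOfRecord₁₃At K₀ jcut sh`): each is a witness for the `∃`-form above.  NOT a closure of K3⁷. [folklore] -/
theorem spineGivenEndpointR13SepCoPH_of_ratesHolder_linkReading_crOfRecord₁₃At_faces
    (ks : (F : T4Family) → (θ : Stage13HParams F 2) → θ.Provisos₁₃CoPH F 2 → (ℕ → ℝ) → List (ULoop F) → ℕ)
    (E : (F : T4Family) → (θ : Stage13HParams F 2) → θ.Provisos₁₃CoPH F 2 → B12.RunParams → ℝ)
    (hsel : ∀ (F : T4Family) (θ : Stage13HParams F 2) (hP : θ.Provisos₁₃CoPH F 2), (θ.ZhUnity F 2 ∧ θ.SlotsNondegenerate₁₃ F 2) → θ.Admissible F 2 →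
      θ.ppSel = ppSelLiveOfRecord F 2 θ.ν θ.τ9 (E F θ hP) (wOfRecord₉ F 2 θ.toStage9Params))
    (hζm : ∀ (F : T4Family) (θ : Stage13HParams F 2) (hP : θ.Provisos₁₃CoPH F 2), (θ.ZhUnity F 2 ∧ θ.SlotsNondegenerate₁₃ F 2) → θ.Admissible F 2 →
      ZetaMeasurable F 2 θ.ζ)
    (hζ0 : ∀ (F : T4Family) (θ : Stage13HParams F 2) (hP : θ.Provisos₁₃CoPH F 2), (θ.ZhUnity F 2 ∧ θ.SlotsNondegenerate₁₃ F 2) → θ.Admissible F 2 →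
      ∀ p g k s Pl Ql RS U V', 0 ≤ θ.ζ p g k s Pl Ql RS U V')
    (h20 : ∀ (F : T4Family) (θ : Stage13HParams F 2) (hP : θ.Provisos₁₃CoPH F 2), (θ.ZhUnity F 2 ∧ θ.SlotsNondegenerate₁₃ F 2) → θ.Admissible F 2 →
      ∀ (g₀ : ℕ → ℝ) (os : List (ULoop F)),
      RelWeightBound (crOfRecord₁₃At K₀ jcut sh F θ hP g₀ os).l₀ (crOfRecord₁₃At K₀ jcut sh F θ hP g₀ os).T (crOfRecord₁₃At K₀ jcut sh F θ hP g₀ os).A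
        (crOfRecord₁₃At K₀ jcut sh F θ hP g₀ os).B (crOfRecord₁₃At K₀ jcut sh F θ hP g₀ os).Bad (crOfRecord₁₃At K₀ jcut sh F θ hP g₀ os).W)
    (h21 : ∀ (F : T4Family) (θ : Stage13HParams F 2) (hP : θ.Provisos₁₃CoPH F 2), (θ.ZhUnity F 2 ∧ θ.SlotsNondegenerate₁₃ F 2) → θ.Admissible F 2 →
      ∀ (g₀ : ℕ → ℝ) (os : List (ULoop F)),
      ShellWeightBound (crOfRecord₁₃At K₀ jcut sh F θ hP g₀ os).l₀ (crOfRecord₁₃At K₀ jcut sh F θ hP g₀ os).T (crOfRecord₁₃At K₀ jcut sh F θ hP g₀ os).A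
        (crOfRecord₁₃At K₀ jcut sh F θ hP g₀ os).B (crOfRecord₁₃At K₀ jcut sh F θ hP g₀ os).shA (crOfRecord₁₃At K₀ jcut sh F θ hP g₀ os).shB
        (crOfRecord₁₃At K₀ jcut sh F θ hP g₀ os).Wsh)
    (hrates : ∀ (F : T4Family) (θ : Stage13HParams F 2) (hP : θ.Provisos₁₃CoPH F 2), (θ.ZhUnity F 2 ∧ θ.SlotsNondegenerate₁₃ F 2) → θ.Admissible F 2 →
      ∀ (g₀ : ℕ → ℝ) (os : List (ULoop F)),
      RatesHolderAt (datumOfRecord₁₃CoPH F 2 θ hP) (rateCarriersOfRecord₁₃CoPH 𝔯 F θ hP g₀ os (ks F θ hP g₀ os)) β) :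
    SpineGivenEndpointR13SepCoPH :=
  spineGivenEndpointR13SepCoPH_of_ratesHolder_linkReading_crOfRecord₁₃At K₀ jcut sh 𝔯 hβ1 hlink ks E hsel hζm hζ0
    (fun F θ hP hG hθ g₀ os => ⟨_, h20 F θ hP hG hθ g₀ os⟩) (fun F θ hP hG hθ g₀ os => ⟨_, h21 F θ hP hG hθ g₀ os⟩) hrates

end Item

end Summit.QuantumFields.YangMills.BalabanUVNodes.N19RateEdgeHolderK3R13SepCoPHAtSpineReading

end
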